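import Summits.QuantumFields.YangMills.Theorems.LangevinControlUVOSLegsFromFemtoAndGapStubAssemblyStrings
import Literature.MathematicalPhysics.QuantumFieldTheory.SchwingerLimitInheritance
import HarnessLib

/-!
# Soft OS-assembly toolkit VIII-b: E0 (normalisation), E3 and E1-translations of subsequential limits

Helper file for stub `stub_assembly`/`stub_assembly6` of crux `OSLegsFromFemtoAndGap` (stmt-QuantumFields-9367,
line `dlr-collar-transfer`).  For the one-field lattice families `j ↦ (n ↦ latticeDist ρ βⱼ Lⱼ aⱼ O mⱼ n)` of a
bounded local observable `O` and ANY pointwise limit `T` on `⁰𝒮` obeying a uniform E0′-type bound (toolkits VI-c,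
VII), the exact lattice facts of toolkit VIII-a and the tree's inheritance theorems
(`Literature/…/SchwingerLimitInheritance.lean`) give: `T` is normalised (`latticeDist_zero_apply`: the zero-point
distribution is evaluation), symmetric (E3: the one-field lattice family is exactly symmetric), and invariant
under ALL translations of `ℝ⁴` on `⁰𝒮` (lattice vectors `aⱼ vⱼ → t` with the translation defect `O(aⱼ)` of
`norm_latticeDistStr_translate_sub_le`).
-/

noncomputable section

open scoped SchwartzMap BigOperators
open MeasureTheory Filter Topology
open Literature.MathematicalPhysics.QuantumFieldTheory Literature.MathematicalPhysics.QuantumLattice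
open Literature.MathematicalPhysics.AQFT
open Literature.Probability.LatticeModels (box Site mem_box)

namespace Summit.QuantumFields.YangMills.Theorems.OSLegsFromFemtoAndGap

local notation "E4" => EuclideanSpace ℝ (Fin 4)

variable {G : Type} [Group G] [TopologicalSpace G] [IsTopologicalGroup G] [CompactSpace G]
  [MeasurableSpace G] [BorelSpace G]

/-! ### E0: the zero-point distribution is evaluation -/

/-- The zero-point lattice distribution is evaluation at the (unique) empty configuration. -/
theorem latticeDist_zero_apply {N : ℕ} (ρ : G →* Matrix (Fin N) (Fin N) ℂ) (hρ : Continuous ρ) (β : ℝ)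
    (L : ℕ) (a : ℝ) (O : LGConfig 4 G → ℝ) (m : ℝ) (F : 𝓢((Fin 0 → E4), ℂ)) :
    latticeDist ρ β L a O m 0 F = F default := by
  haveI := isProbabilityMeasure_wilsonMeasure (d := 4) (L := 2 * L + 1) ρ hρ β
  rw [latticeDist_apply]
  have hS : Fintype.piFinset (fun _ : Fin 0 => box 4 L) = {default} := by
    ext x
    simp only [Fintype.mem_piFinset, IsEmpty.forall_iff, Finset.mem_singleton, true_iff]
    exact Subsingleton.elim _ _
  rw [hS, Finset.sum_singleton]
  have hW : torusMoment ρ β L O m (default : Fin 0 → Site 4) = 1 := by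
    simp [torusMoment]
  rw [hW, Complex.ofReal_one, one_mul]
  congr 1
  exact Subsingleton.elim _ _

/-! ### The one-field lattice family and its exact symmetry -/

/-- The one-field lattice family is exactly symmetric (E3 on the lattice). -/
theorem isSymmetric_latticeDist {N : ℕ} (ρ : G →* Matrix (Fin N) (Fin N) ℂ) (β : ℝ) (L : ℕ) (a : ℝ)
    (O : LGConfig 4 G → ℝ) (m : ℝ) :
    (SchwingerFamily.toLabelled (E := E4) fun n => latticeDist ρ β L a O m n).IsSymmetric := by
  intro n k π F _
  simp only [SchwingerFamily.toLabelled_apply]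
  rw [latticeDist_eq_latticeDistStr, latticeDistStr_permTest]
  rfl

/-! ### Lattice approximation of a translation vector -/

/-- The lattice vector `⌊t/a⌋` (coordinatewise). -/
theorem norm_smul_siteToE_floor_sub_le (t : E4) {a : ℝ} (ha : 0 < a) :
    ‖a • siteToE (fun k : Fin 4 => ⌊t k / a⌋) - t‖ ≤ 2 * a := by
  have hcoord : ∀ k : Fin 4, |a * (⌊t k / a⌋ : ℝ) - t k| ≤ a := by
    intro k
    have h1 := Int.floor_le (t k / a)
    have h2 := Int.lt_floor_add_one (t k / a)
    have h3 : a * (⌊t k / a⌋ : ℝ) ≤ t k := by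
      calc a * (⌊t k / a⌋ : ℝ) ≤ a * (t k / a) := by gcongr
        _ = t k := by field_simp
    have h4 : t k < a * (⌊t k / a⌋ : ℝ) + a := by
      calc t k = a * (t k / a) := by field_simp
        _ < a * ((⌊t k / a⌋ : ℝ) + 1) := by gcongr
        _ = _ := by ring
    rw [abs_le]; constructor <;> linarith
  rw [EuclideanSpace.norm_eq]
  have hsum : ∑ k : Fin 4, ‖(a • siteToE (fun k : Fin 4 => ⌊t k / a⌋) - t) k‖ ^ 2 ≤ ∑ _k : Fin 4, a ^ 2 := by
    refine Finset.sum_le_sum fun k _ => ?_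
    have : ‖(a • siteToE (fun k : Fin 4 => ⌊t k / a⌋) - t) k‖ ≤ a := by
      rw [PiLp.sub_apply, PiLp.smul_apply, siteToE_apply, smul_eq_mul, Real.norm_eq_abs]
      exact hcoord k
    exact pow_le_pow_left₀ (norm_nonneg _) this 2
  calc Real.sqrt (∑ k : Fin 4, ‖(a • siteToE (fun k : Fin 4 => ⌊t k / a⌋) - t) k‖ ^ 2)
      ≤ Real.sqrt (∑ _k : Fin 4, a ^ 2) := Real.sqrt_le_sqrt hsum
    _ = Real.sqrt ((2 * a) ^ 2) := by congr 1; simp; ring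
    _ = 2 * a := Real.sqrt_sq (by positivity)

/-- `|⌊x⌋| ≤ |x| + 1`. -/
theorem abs_floor_le (x : ℝ) : |((⌊x⌋ : ℤ) : ℝ)| ≤ |x| + 1 := by
  have h1 := Int.floor_le x
  have h2 := Int.sub_one_lt_floor x
  rw [abs_le]; constructor
  · linarith [neg_abs_le x]
  · linarith [le_abs_self x]

/-- The sup norm of the lattice vector `⌊t/a⌋` is at most `‖t‖/a + 1`. -/
theorem norm_floor_le (t : E4) {a : ℝ} (ha : 0 < a) :
    ‖(fun k : Fin 4 => ⌊t k / a⌋ : Site 4)‖ ≤ ‖t‖ / a + 1 := by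
  refine (pi_norm_le_iff_of_nonneg (by positivity)).2 fun k => ?_
  rw [Int.norm_eq_abs]
  have htk : |t k| ≤ ‖t‖ := by simpa [Real.norm_eq_abs] using PiLp.norm_apply_le t k
  calc |((⌊t k / a⌋ : ℤ) : ℝ)| ≤ |t k / a| + 1 := abs_floor_le _
    _ = |t k| / a + 1 := by rw [abs_div, abs_of_pos ha]
    _ ≤ ‖t‖ / a + 1 := by gcongr

/-! ### Inheritance for the one-field lattice families -/

/-- **E0, E3 and E1-translations of subsequential limits of the one-field lattice families.**  Let
`T` be a pointwise limit on `⁰𝒮` of `j ↦ (n ↦ latticeDist ρ βⱼ Lⱼ aⱼ O mⱼ n)` with a uniform E0′-type bound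
(eventually in `j`), the weights bounded by `Mⁿ`, spacings `0 < aⱼ ≤ 1`, `aⱼ → 0`, tori `Lⱼ ≥ aⱼ⁻²`.  Then `T` is
normalised, symmetric, and translation invariant on `⁰𝒮`. -/
theorem limit_isNormalized_isSymmetric_translate {N : ℕ} (ρ : G →* Matrix (Fin N) (Fin N) ℂ)
    (hρ : Continuous ρ) (βs : ℕ → ℝ) (Ls : ℕ → ℕ) (as : ℕ → ℝ) (O : LGConfig 4 G → ℝ) (ms : ℕ → ℝ)
    (T : SchwingerFamily E4)
    (hconv : ∀ (n : ℕ) (F : 𝓢((Fin n → E4), ℂ)), IsOffDiagonal F →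
      Tendsto (fun j => latticeDist ρ (βs j) (Ls j) (as j) O (ms j) n F) atTop (𝓝 (T n F)))
    (σ : ℕ → ℝ) (mm : ℕ → ℕ)
    (hb : ∀ n, ∀ᶠ j in atTop, ∀ F : 𝓢((Fin n → E4), ℂ), IsOffDiagonal F →
      ‖latticeDist ρ (βs j) (Ls j) (as j) O (ms j) n F‖ ≤ σ n * schwartzNorm (mm n) F)
    {M : ℝ} (hM : 0 ≤ M)
    (hW : ∀ (n j : ℕ) (x : Fin n → Site 4), |torusMoment ρ (βs j) (Ls j) O (ms j) x| ≤ M ^ n)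
    (ha : ∀ j, 0 < as j) (ha1 : ∀ j, as j ≤ 1) (hLa : ∀ j, (as j)⁻¹ * (as j)⁻¹ ≤ Ls j)
    (ha0 : Tendsto as atTop (𝓝 0)) :
    T.toLabelled.IsNormalized ∧ T.toLabelled.IsSymmetric ∧
      ∀ (n : ℕ) (t : E4) (F : 𝓢((Fin n → E4), ℂ)), IsOffDiagonal F → T n (translateMulti t F) = T n F := by
  refine ⟨?_, ?_, ?_⟩
  · -- E0: every lattice family is normalised
    refine isNormalized_of_tendsto (S := fun j n => latticeDist ρ (βs j) (Ls j) (as j) O (ms j) n) hconv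
      (Eventually.of_forall fun j k F => ?_)
    simp only [SchwingerFamily.toLabelled_apply]
    exact (latticeDist_zero_apply ρ hρ _ _ _ O _ F).trans (congrArg F (Subsingleton.elim _ _))
  · -- E3: every lattice family is symmetric
    exact isSymmetric_of_tendsto (S := fun j n => latticeDist ρ (βs j) (Ls j) (as j) O (ms j) n) hconv
      (Eventually.of_forall fun j => isSymmetric_latticeDist ρ _ _ _ O _)
  · -- E1 translations: lattice vectors `aⱼ ⌊t/aⱼ⌋ → t`, defect `O(aⱼ)`
    intro n t F hF
    set v : ℕ → Site 4 := fun j k => ⌊t k / as j⌋ with hv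
    set b : ℕ → E4 := fun j => as j • siteToE (v j) with hbdef
    have hba : Tendsto b atTop (𝓝 t) := by
      rw [tendsto_iff_norm_sub_tendsto_zero]
      refine squeeze_zero (fun j => norm_nonneg _) (fun j => norm_smul_siteToE_floor_sub_le t (ha j)) ?_
      simpa using ha0.const_mul 2
    refine translateMulti_apply_eq_of_tendsto (S := fun j n => latticeDist ρ (βs j) (Ls j) (as j) O (ms j) n)
      (hconv n) (hb n) hba (fun F' hF' => ?_) F hF
    -- the defect bound, eventually (once `2‖vⱼ‖ ≤ Lⱼ`)
    have hev : ∀ᶠ j in atTop, 2 * ‖v j‖ ≤ (Ls j : ℝ) := by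
      -- `2(‖t‖/a + 1) ≤ a⁻² ≤ L` as soon as `2‖t‖ a + 2 a² ≤ 1`
      have h1 : Tendsto (fun j => 2 * ‖t‖ * as j + 2 * (as j * as j)) atTop (𝓝 0) := by
        simpa using ((ha0.const_mul (2 * ‖t‖)).add ((ha0.mul ha0).const_mul 2))
      have h2 : ∀ᶠ j in atTop, 2 * ‖t‖ * as j + 2 * (as j * as j) ≤ 1 :=
        (h1.eventually (ge_mem_nhds one_pos)).mono fun j hj => hj
      refine h2.mono fun j hj => ?_
      have hvj := norm_floor_le t (ha j)
      have haj := ha j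
      have hLj := hLa j
      -- `2 ‖v j‖ ≤ 2‖t‖/a + 2 ≤ a⁻² ≤ L`
      have h3 : 2 * (‖t‖ / as j + 1) ≤ (as j)⁻¹ * (as j)⁻¹ := by
        rw [div_eq_mul_inv]
        have hinv : 0 < (as j)⁻¹ := inv_pos.2 haj
        have key : (2 * ‖t‖ * as j + 2 * (as j * as j)) * ((as j)⁻¹ * (as j)⁻¹) ≤ 1 * ((as j)⁻¹ * (as j)⁻¹) :=
          mul_le_mul_of_nonneg_right hj (by positivity)
        have hexp : (2 * ‖t‖ * as j + 2 * (as j * as j)) * ((as j)⁻¹ * (as j)⁻¹) =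
            2 * (‖t‖ * (as j)⁻¹ + 1) := by field_simp
        linarith [hexp ▸ key]
      calc 2 * ‖v j‖ ≤ 2 * (‖t‖ / as j + 1) := by rw [hv]; linarith [hvj]
        _ ≤ (as j)⁻¹ * (as j)⁻¹ := h3
        _ ≤ Ls j := hLj
    have hbound : ∀ᶠ j in atTop,
        ‖latticeDist ρ (βs j) (Ls j) (as j) O (ms j) n (translateMulti (b j) F') -
            latticeDist ρ (βs j) (Ls j) (as j) O (ms j) n F'‖ ≤
          2 * 3 ^ (4 * n) * 2 ^ (8 * n + 1) * M ^ n * SchwartzMap.seminorm ℂ (8 * n + 1) 0 F' * as j :=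
      hev.mono fun j hj => by
        rw [latticeDist_eq_latticeDistStr]
        exact norm_latticeDistStr_translate_sub_le ρ (βs j) (Ls j) (fun _ => O) (fun _ => ms j) hM
          (fun x => hW n j x) (ha j) (ha1 j) (hLa j) (v j) hj F'
    refine squeeze_zero_norm' hbound ?_
    simpa using ha0.const_mul (2 * 3 ^ (4 * n) * 2 ^ (8 * n + 1) * M ^ n * SchwartzMap.seminorm ℂ (8 * n + 1) 0 F')

end Summit.QuantumFields.YangMills.Theorems.OSLegsFromFemtoAndGap

end
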